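import Literature.AlgebraicGeometry.HodgeTheory.HodgeConjectureProductsThreefoldsSmallChowZero
import Literature.AlgebraicGeometry.HodgeTheory.BettiHodgeConjectureSquareOffMiddleAlgebraic
import Literature.AlgebraicGeometry.HodgeTheory.MaxRationalSubHodgeStructureKunnethSymmetric
import Literature.AlgebraicGeometry.Motives.FanoRationallyChainConnected
import HarnessLib

/-!
# `HC(F × C)`, `HC(F × S)`, `HC(F × T)` for a FOURFOLD `F` with `N¹H³(F) = H³(F)` by coniveau; unconditionally for every fourfold whose `CH₀` is supported on a surface: times every curve, times every
# surface with `p_g = 0`, times every threefold with `CH₀` on a curve (or on a surface with `h^{2,0} = 0`: rationally chain connected, Fano granted KMM, hypersurfaces of degree `≤ 4` in `ℙ⁴`)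
# (Bloch–Srinivas 1983 Thm. 1; Voisin II Thm. 10.17, Cor. 10.18/10.21, Prop. 10.26, Thm. 10.31; Voisin 2013 Lemma 2.1; Voisin I §11.3.3 Thm. 11.38–11.40, Lemma 11.41, pp. 285–287, Thm. 11.30; Conte–Murre 1978)

Family `hodge`, lane `lit-hodgefound` (Track 2 foundations library; Layers A1/A4), layer `Literature/AlgebraicGeometry/HodgeTheory`.  THEOREMS ONLY (no definition, no named fact, no instance;
D-0026 net debt `0`).  The `CH₀` companion of the seat's g33-#2 (`BettiHodgeConjectureFourfoldProductsHodgeNumbers`, the numerical `F × X` criteria).  The reduced window of `F × T` (`F` a fourfold,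
`T` a threefold) consists of `H¹ ⊗ H'³`, `H² ⊗ H'²`, `H³ ⊗ H'¹ ⊂ H⁴` and `H³ ⊗ H'³`, `H⁴ ⊗ H'² ⊂ H⁶`; by Voisin 2013 Lemma 2.1 on the tree's carriers
(`BettiUniverse.ofRatClass_crossMap_mem_algebraicClasses_of_supportedClasses_eq_top`: coniveaux `r` on `Hⁱ(F)`, `s` on `Hʲ(T)` with `c − 1 ≤ r + s` suffice, and `N⁰ = everything`) the pieces with an
`H³`-factor are algebraic as soon as **`N¹H³(F) = H³(F)`** and **`N¹H³(T) = H³(T)`**, and the two even pieces drop out when one factor consists of divisor classes / Hodge classes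
(`h^{2,0}(F)·h^{2,0}(T) = 0`; `Hdg²(H⁴F) = H⁴(F;ℚ)` or `h^{2,0}(T) = 0`).  For `F × S` the pieces are `H² ⊗ H'²`, `H³ ⊗ H'¹`, `H⁴ ⊗ H'²`; for `F × C` only `H³ ⊗ H'¹`.  Bloch–Srinivas turns «`CH₀(F)` supported
on a surface» into `N¹Hˡ(F) = Hˡ(F)` for `l ≥ 3` (the tree's `supportedClasses_eq_top_of_hasChowZeroSupportedInDimLE_of_lt`) AND into `HC(F)` itself (the tree's
`hodgeConjectureFor_four_of_hasChowZeroSupportedInDimLE`, Bloch–Srinivas Thm. 1 (3) / Conte–Murre), whence the UNCONDITIONAL statements of §4: **for every smooth projective fourfold `F` whose `CH₀` is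
supported on a surface, `HC(F × C)` for every curve, `HC(F × S)` for every surface with `p_g(S) = 0`, and `HC(F × T)` for every threefold `T` with `CH₀` on a curve** (or on a surface with `h^{2,0}(T) = 0`:
rationally chain connected threefolds, Fano threefolds granted Kollár–Miyaoka–Mori, smooth hypersurfaces of degree `≤ 4` in `ℙ⁴`); e.g. `HC(F × F')`-type statements are NOT claimed (the piece
`H⁴ ⊗ H'⁴`).  Mirrors by the tree's `hodgeConjectureFor_tensor_comm_mp`.

WHAT IS PROVED.
* §1 **`BettiUniverse.hodgeConjectureFor_fourfold_tensor_curve_of_supportedClasses_three_eq_top`** (`HC(F)`, `N¹H³(F) = H³(F)` ⟹ `HC(F × C)`).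
* §2 **`BettiUniverse.hodgeConjectureFor_fourfold_tensor_surface_of_supportedClasses_three_eq_top`** (`HC(F)`, `N¹H³(F) = H³(F)`, `h^{2,0}(F)·h^{2,0}(S) = 0`, [`Hdg²(H⁴F) = ⊤` or `h^{2,0}(S) = 0`]).
* §3 **`BettiUniverse.hodgeConjectureFor_fourfold_tensor_threefold_of_supportedClasses_three_eq_top`** (`HC(F)`, `N¹H³(F) = H³(F)`, `N¹H³(T) = H³(T)`, `h^{2,0}(F)·h^{2,0}(T) = 0`, [`Hdg²(H⁴F) = ⊤` or
  `h^{2,0}(T) = 0`]).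
* §4 (no instance, no Hodge-model, no `HC(F)` hypothesis) **`hodgeConjectureFor_fourfold_tensor_curve_of_hasChowZeroSupportedInDimLE_two`**, **`…_tensor_surface_of_hasChowZeroSupportedInDimLE_two_of_pg_zero`**,
  **`…_tensor_threefold_of_hasChowZeroSupportedInDimLE_two_of_h20_zero`**, **`…_tensor_threefold_of_hasChowZeroSupportedInDimLE_two_one`**, **`…_of_isRationallyChainConnected`**, **`…_of_isFano`** (both
  factors Fano, granted `KollarMiyaokaMori1992_fano_rationallyChainConnected`), **`IsSmoothHypersurface.hodgeConjectureFor_fourfold_tensor_of_degree_le_four_of_hasChowZeroSupportedInDimLE_two`**, mirrors.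

THE PRINTS.  S. Bloch, V. Srinivas (1983) [BlochSrinivas1983] Thm. 1.  C. Voisin (2003) [VoisinHodgeII2003] §10.2.2 Thm. 10.17, Cor. 10.18, Cor. 10.21; §10.2.3 Prop. 10.26; §10.3.1 Thm. 10.31.  C. Voisin (2013)
[Voisin2013GHCBloch] Lemma 2.1 (proof).  C. Voisin (2002) [VoisinHodgeI2002] §11.3.1 Thm. 11.30; §11.3.3 Thm. 11.38–11.40, Lemma 11.41, pp. 285–287.  A. Conte, J. P. Murre (1978) [ConteMurre1978] Thm. 1.
J. Kollár, Y. Miyaoka, S. Mori (1992) [KollarMiyaokaMori1992] Thm. 3.3.  A. Arapura (2006) [Arapura2006] §4 Lemma 4.2.  P. Deligne (2000/2006) [Deligne2000] §1.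

THE OBJECTS (all the tree's).  `BettiUniverse.kunnethSummand`, `BettiUniverse.crossMap`, `BettiUniverse.hodge`, `hodgeClasses`, `supportedClasses`, `algebraicClasses`, `ofRatClass`, `HodgeConjectureFor`,
`Barriers.HodgeConjecture.HasChowZeroSupportedInDimLE`, `IsRationallyChainConnected`, `IsFano`, `Motives.IsSmoothHypersurface 3 e`; the tree's generic assembly
`BettiUniverse.hodgeConjectureFor_tensor_of_kunneth_pieces_pos_le`, the piece lemmas `BettiUniverse.ofRatClass_crossMap_mem_algebraicClasses_of_supportedClasses_eq_top` / `…_of_hodgeClasses_eq_top_left/right`,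
`supportedClasses_zero`, `supportedClasses_eq_top_of_hasChowZeroSupportedInDimLE_of_lt`, `hodgeConjectureFor_four_of_hasChowZeroSupportedInDimLE`, `BettiUniverse.hodgeNumber_eq_zero_of_hasChowZeroSupportedInDimLE_of_lt`,
`IsRationallyChainConnected.hasChowZeroSupportedInDimLE_zero`, `IsSmoothHypersurface.hasChowZeroSupportedInDimLE_of_degree_le_succ`, `hodgeConjectureFor_tensor_comm_mp`, `hodgeTensorFacts_holds`,
`exists_isReal_hodgeModel_holds`, `IsSmoothProjective.tensor_holds`.

DEVIATIONS / SCOPE.  Complex orientations.  §1–§3 keep `[HodgeTensorFacts.{0,0}]`, `hHD`, `HC(F)` and an arbitrary smooth projective structure on the product; §4 discharges all of them.  No definitions.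

## References
* [BlochSrinivas1983] S. Bloch, V. Srinivas, Remarks on correspondences and algebraic cycles, Amer. J. Math. 105 (1983) — Thm. 1.
* [VoisinHodgeII2003] C. Voisin, *Hodge Theory and Complex Algebraic Geometry II* (2003) — §10.2.2 Thm. 10.17, Cor. 10.18, Cor. 10.21; §10.2.3 Prop. 10.26; §10.3.1 Thm. 10.31.
* [Voisin2013GHCBloch] C. Voisin, The generalized Hodge and Bloch conjectures are equivalent for general complete intersections (2013) — Lemma 2.1.
* [VoisinHodgeI2002] C. Voisin, *Hodge Theory and Complex Algebraic Geometry I* (2002) — §11.3.1 Thm. 11.30; §11.3.3 Thm. 11.38–11.40, Lemma 11.41, pp. 285–287.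
* [ConteMurre1978] A. Conte, J. P. Murre, The Hodge conjecture for fourfolds admitting a covering by rational curves, Math. Ann. 238 (1978) — Thm. 1.
* [KollarMiyaokaMori1992] J. Kollár, Y. Miyaoka, S. Mori, Rational connectedness and boundedness of Fano manifolds (1992) — Thm. 3.3.
* [Arapura2006] D. Arapura, Motivation for Hodge cycles (2006) — §4 Lemma 4.2.
* [Deligne2000] P. Deligne, *The Hodge conjecture* (Clay problem description) — §1.

## Provenance
Lane `lit-hodgefound` (Hodge path, Track 2), prover seat `lit-hodgefound-p29` (generation 33), self-proposed row g33-#5 (the `CH₀` / coniveau companion of g33-#2 for a fourfold first factor).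
-/

noncomputable section

open scoped TensorProduct
open CategoryTheory MonoidalCategory CartesianMonoidalCategory Module Finset
open Literature.AlgebraicTopology.SingularHomology
open Literature.Geometry.Kaehler
open Literature.Barriers.HodgeConjecture

namespace Literature.AlgebraicGeometry.HodgeTheory

open Literature.AlgebraicGeometry.Motives
open Literature.AlgebraicGeometry.Motives.HodgeStructure

variable {d : ℕ} {F C S T : SchemeOver ℂ}

section Hodge

variable [HodgeTensorFacts.{0, 0}]

/-! ### §1 `F × C` -/

/-- **`HC(F × C)` for a smooth projective fourfold `F` with `HC(F)` and `N¹H³(F) = H³(F)`, and every smooth projective curve `C`**: the reduced window of `F × C` is the single piece `H³(F) ⊗ H¹(C) ⊂ H⁴`,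
of coniveau `≥ 1 + 0 = c − 1`. [cite: Voisin2013GHCBloch, Lemma 2.1 (proof)] [cite: VoisinHodgeI2002, §11.3.3 Thm. 11.38–11.40, Lemma 11.41 and pp. 285–287, §11.3.1 Thm. 11.30] [cite: Deligne2000, §1] -/
theorem BettiUniverse.hodgeConjectureFor_fourfold_tensor_curve_of_supportedClasses_three_eq_top (hHD : exists_isReal_hodgeModel) (hF : IsSmoothProjective 4 F) (hC : IsSmoothProjective 1 C)
    (hFC : IsSmoothProjective d (F ⊗ C)) (hHCF : HodgeConjectureFor 4 F) (hF3 : supportedClasses F 3 1 = ⊤) : HodgeConjectureFor d (F ⊗ C) := by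
  refine BettiUniverse.hodgeConjectureFor_tensor_of_kunneth_pieces_pos_le hHD hF hC hFC hHCF (hodgeConjectureFor_of_dim_le_three_holds (by norm_num) hC)
    fun c i j hij hi1 hi hj1 hj hc2 t ht ↦ ?_
  obtain rfl : j = 1 := by omega
  obtain rfl : i = 3 := by omega
  obtain rfl : c = 2 := by omega
  exact BettiUniverse.ofRatClass_crossMap_mem_algebraicClasses_of_supportedClasses_eq_top hHD hF hC hFC (i := 3) (j := 1) (p := 1) (r := 1) (s := 0) (by norm_num) (by norm_num)
    hF3 (supportedClasses_zero C 1) ht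

/-! ### §2 `F × S` -/

/-- **`HC(F × S)` for a smooth projective fourfold `F` with `HC(F)`, `N¹H³(F) = H³(F)`, and a smooth projective surface `S` with `h^{2,0}(F)·h^{2,0}(S) = 0` and [`Hdg²(H⁴(F)) = H⁴(F;ℚ)` or `h^{2,0}(S) = 0`]**:
the pieces are `H²(F) ⊗ H²(S)`, `H³(F) ⊗ H¹(S) ⊂ H⁴` and `H⁴(F) ⊗ H²(S) ⊂ H⁶`. [cite: Voisin2013GHCBloch, Lemma 2.1 (proof)] [cite: VoisinHodgeI2002, §7.1.1, §11.3.3 Thm. 11.38–11.40, Lemma 11.41 and pp. 285–287, §11.3.1 Thm. 11.30]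
[cite: Deligne2000, §1] -/
theorem BettiUniverse.hodgeConjectureFor_fourfold_tensor_surface_of_supportedClasses_three_eq_top (hHD : exists_isReal_hodgeModel) (hF : IsSmoothProjective 4 F) (hS : IsSmoothProjective 2 S)
    (hFS : IsSmoothProjective d (F ⊗ S)) (hHCF : HodgeConjectureFor 4 F) (hF3 : supportedClasses F 3 1 = ⊤)
    (h22 : (BettiUniverse.hodge hHD hF 2).hodgeNumber 2 0 * (BettiUniverse.hodge hHD hS 2).hodgeNumber 2 0 = 0)
    (h42 : (BettiUniverse.hodge hHD hF 4).hodgeClasses 2 = ⊤ ∨ (BettiUniverse.hodge hHD hS 2).hodgeNumber 2 0 = 0) : HodgeConjectureFor d (F ⊗ S) := by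
  have hHCS : HodgeConjectureFor 2 S := hodgeConjectureFor_of_dim_le_three_holds (by norm_num) hS
  have halgF : ∀ (p : ℕ), ∀ z ∈ (BettiUniverse.hodge hHD hF (2 * p)).hodgeClasses (p : ℤ), ofRatClass (ComplexPoints F) (2 * p) z ∈ algebraicClasses F p :=
    fun p z hz ↦ hHCF.2 p _ (isRationalClass_ofRatClass _) ((BettiUniverse.mem_hodgeClasses_hodge_iff_isOfHodgeType hHD hF p z).1 hz)
  have halgS : ∀ (p : ℕ), ∀ z ∈ (BettiUniverse.hodge hHD hS (2 * p)).hodgeClasses (p : ℤ), ofRatClass (ComplexPoints S) (2 * p) z ∈ algebraicClasses S p :=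
    fun p z hz ↦ hHCS.2 p _ (isRationalClass_ofRatClass _) ((BettiUniverse.mem_hodgeClasses_hodge_iff_isOfHodgeType hHD hS p z).1 hz)
  refine BettiUniverse.hodgeConjectureFor_tensor_of_kunneth_pieces_pos_le hHD hF hS hFS hHCF hHCS fun c i j hij hi1 hi hj1 hj hc2 t ht ↦ ?_
  have hcases : (c = 2 ∧ (i = 2 ∧ j = 2 ∨ i = 3 ∧ j = 1)) ∨ (c = 3 ∧ i = 4 ∧ j = 2) := by omega
  rcases hcases with ⟨rfl, ⟨rfl, rfl⟩ | ⟨rfl, rfl⟩⟩ | ⟨rfl, rfl, rfl⟩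
  · -- `H²(F) ⊗ H²(S)`
    rcases mul_eq_zero.1 h22 with h | h
    · have htop : (BettiUniverse.hodge hHD hF (2 * 1)).hodgeClasses (1 : ℕ) = ⊤ := (BettiUniverse.hodgeClasses_hodge_two_eq_top_iff hHD hF).2 h
      exact BettiUniverse.ofRatClass_crossMap_mem_algebraicClasses_of_hodgeClasses_eq_top_left hHD hF hS (a := 1) (b := 1) (c := 2) (by norm_num) htop
        (fun u ↦ halgF 1 u (by rw [htop]; exact Submodule.mem_top)) (halgS 1) ht
    · have htop : (BettiUniverse.hodge hHD hS (2 * 1)).hodgeClasses (1 : ℕ) = ⊤ := (BettiUniverse.hodgeClasses_hodge_two_eq_top_iff hHD hS).2 h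
      exact BettiUniverse.ofRatClass_crossMap_mem_algebraicClasses_of_hodgeClasses_eq_top_right hHD hF hS (a := 1) (b := 1) (c := 2) (by norm_num) htop (halgF 1)
        (fun w ↦ halgS 1 w (by rw [htop]; exact Submodule.mem_top)) ht
  · -- `H³(F) ⊗ H¹(S)`
    exact BettiUniverse.ofRatClass_crossMap_mem_algebraicClasses_of_supportedClasses_eq_top hHD hF hS hFS (i := 3) (j := 1) (p := 1) (r := 1) (s := 0) (by norm_num) (by norm_num)
      hF3 (supportedClasses_zero S 1) ht
  · -- `H⁴(F) ⊗ H²(S)`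
    rcases h42 with htop | h
    · -- the same `⊤`, at the index `2 * 2` of the piece lemmas
      have htop' : (BettiUniverse.hodge hHD hF (2 * 2)).hodgeClasses ((2 : ℕ) : ℤ) = ⊤ := htop
      exact BettiUniverse.ofRatClass_crossMap_mem_algebraicClasses_of_hodgeClasses_eq_top_left hHD hF hS (a := 2) (b := 1) (c := 3) (by norm_num) htop'
        (fun u ↦ halgF 2 u (by rw [htop']; exact Submodule.mem_top)) (halgS 1) ht
    · have htop : (BettiUniverse.hodge hHD hS (2 * 1)).hodgeClasses (1 : ℕ) = ⊤ := (BettiUniverse.hodgeClasses_hodge_two_eq_top_iff hHD hS).2 h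
      exact BettiUniverse.ofRatClass_crossMap_mem_algebraicClasses_of_hodgeClasses_eq_top_right hHD hF hS (a := 2) (b := 1) (c := 3) (by norm_num) htop (halgF 2)
        (fun w ↦ halgS 1 w (by rw [htop]; exact Submodule.mem_top)) ht

/-! ### §3 `F × T` -/

/-- **`HC(F × T)` for a smooth projective fourfold `F` with `HC(F)` and `N¹H³(F) = H³(F)` and a smooth projective threefold `T` with `N¹H³(T) = H³(T)`, `h^{2,0}(F)·h^{2,0}(T) = 0` and
[`Hdg²(H⁴(F)) = H⁴(F;ℚ)` or `h^{2,0}(T) = 0`]**: the pieces `H¹ ⊗ H'³`, `H³ ⊗ H'¹`, `H³ ⊗ H'³` are of coniveau `≥ c − 1`, the pieces `H² ⊗ H'²`, `H⁴ ⊗ H'²` have a factor of Hodge classes; `HC(T)` holds in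
dimension `3`. [cite: Voisin2013GHCBloch, Lemma 2.1 (proof)] [cite: VoisinHodgeI2002, §7.1.1, §11.3.3 Thm. 11.38–11.40, Lemma 11.41 and pp. 285–287, §11.3.1 Thm. 11.30] [cite: VoisinHodgeII2003, §9.2.4 Prop. 9.20] [cite: Deligne2000, §1] -/
theorem BettiUniverse.hodgeConjectureFor_fourfold_tensor_threefold_of_supportedClasses_three_eq_top (hHD : exists_isReal_hodgeModel) (hF : IsSmoothProjective 4 F) (hT : IsSmoothProjective 3 T)
    (hFT : IsSmoothProjective d (F ⊗ T)) (hHCF : HodgeConjectureFor 4 F) (hF3 : supportedClasses F 3 1 = ⊤) (hT3 : supportedClasses T 3 1 = ⊤)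
    (h22 : (BettiUniverse.hodge hHD hF 2).hodgeNumber 2 0 * (BettiUniverse.hodge hHD hT 2).hodgeNumber 2 0 = 0)
    (h42 : (BettiUniverse.hodge hHD hF 4).hodgeClasses 2 = ⊤ ∨ (BettiUniverse.hodge hHD hT 2).hodgeNumber 2 0 = 0) : HodgeConjectureFor d (F ⊗ T) := by
  have hHCT : HodgeConjectureFor 3 T := hodgeConjectureFor_of_dim_le_three_holds le_rfl hT
  have halgF : ∀ (p : ℕ), ∀ z ∈ (BettiUniverse.hodge hHD hF (2 * p)).hodgeClasses (p : ℤ), ofRatClass (ComplexPoints F) (2 * p) z ∈ algebraicClasses F p :=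
    fun p z hz ↦ hHCF.2 p _ (isRationalClass_ofRatClass _) ((BettiUniverse.mem_hodgeClasses_hodge_iff_isOfHodgeType hHD hF p z).1 hz)
  have halgT : ∀ (p : ℕ), ∀ z ∈ (BettiUniverse.hodge hHD hT (2 * p)).hodgeClasses (p : ℤ), ofRatClass (ComplexPoints T) (2 * p) z ∈ algebraicClasses T p :=
    fun p z hz ↦ hHCT.2 p _ (isRationalClass_ofRatClass _) ((BettiUniverse.mem_hodgeClasses_hodge_iff_isOfHodgeType hHD hT p z).1 hz)
  refine BettiUniverse.hodgeConjectureFor_tensor_of_kunneth_pieces_pos_le hHD hF hT hFT hHCF hHCT fun c i j hij hi1 hi hj1 hj hc2 t ht ↦ ?_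
  have hcases : (c = 2 ∧ (i = 1 ∧ j = 3 ∨ i = 2 ∧ j = 2 ∨ i = 3 ∧ j = 1)) ∨ (c = 3 ∧ (i = 3 ∧ j = 3 ∨ i = 4 ∧ j = 2)) := by omega
  rcases hcases with ⟨rfl, ⟨rfl, rfl⟩ | ⟨rfl, rfl⟩ | ⟨rfl, rfl⟩⟩ | ⟨rfl, ⟨rfl, rfl⟩ | ⟨rfl, rfl⟩⟩
  · -- `H¹(F) ⊗ H³(T)`
    exact BettiUniverse.ofRatClass_crossMap_mem_algebraicClasses_of_supportedClasses_eq_top hHD hF hT hFT (i := 1) (j := 3) (p := 1) (r := 0) (s := 1) (by norm_num) (by norm_num)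
      (supportedClasses_zero F 1) hT3 ht
  · -- `H²(F) ⊗ H²(T)`
    rcases mul_eq_zero.1 h22 with h | h
    · have htop : (BettiUniverse.hodge hHD hF (2 * 1)).hodgeClasses (1 : ℕ) = ⊤ := (BettiUniverse.hodgeClasses_hodge_two_eq_top_iff hHD hF).2 h
      exact BettiUniverse.ofRatClass_crossMap_mem_algebraicClasses_of_hodgeClasses_eq_top_left hHD hF hT (a := 1) (b := 1) (c := 2) (by norm_num) htop
        (fun u ↦ halgF 1 u (by rw [htop]; exact Submodule.mem_top)) (halgT 1) ht
    · have htop : (BettiUniverse.hodge hHD hT (2 * 1)).hodgeClasses (1 : ℕ) = ⊤ := (BettiUniverse.hodgeClasses_hodge_two_eq_top_iff hHD hT).2 h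
      exact BettiUniverse.ofRatClass_crossMap_mem_algebraicClasses_of_hodgeClasses_eq_top_right hHD hF hT (a := 1) (b := 1) (c := 2) (by norm_num) htop (halgF 1)
        (fun w ↦ halgT 1 w (by rw [htop]; exact Submodule.mem_top)) ht
  · -- `H³(F) ⊗ H¹(T)`
    exact BettiUniverse.ofRatClass_crossMap_mem_algebraicClasses_of_supportedClasses_eq_top hHD hF hT hFT (i := 3) (j := 1) (p := 1) (r := 1) (s := 0) (by norm_num) (by norm_num)
      hF3 (supportedClasses_zero T 1) ht
  · -- `H³(F) ⊗ H³(T)`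
    exact BettiUniverse.ofRatClass_crossMap_mem_algebraicClasses_of_supportedClasses_eq_top hHD hF hT hFT (i := 3) (j := 3) (p := 2) (r := 1) (s := 1) (by norm_num) (by norm_num)
      hF3 hT3 ht
  · -- `H⁴(F) ⊗ H²(T)`
    rcases h42 with htop | h
    · have htop' : (BettiUniverse.hodge hHD hF (2 * 2)).hodgeClasses ((2 : ℕ) : ℤ) = ⊤ := htop
      exact BettiUniverse.ofRatClass_crossMap_mem_algebraicClasses_of_hodgeClasses_eq_top_left hHD hF hT (a := 2) (b := 1) (c := 3) (by norm_num) htop'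
        (fun u ↦ halgF 2 u (by rw [htop']; exact Submodule.mem_top)) (halgT 1) ht
    · have htop : (BettiUniverse.hodge hHD hT (2 * 1)).hodgeClasses (1 : ℕ) = ⊤ := (BettiUniverse.hodgeClasses_hodge_two_eq_top_iff hHD hT).2 h
      exact BettiUniverse.ofRatClass_crossMap_mem_algebraicClasses_of_hodgeClasses_eq_top_right hHD hF hT (a := 2) (b := 1) (c := 3) (by norm_num) htop (halgF 2)
        (fun w ↦ halgT 1 w (by rw [htop]; exact Submodule.mem_top)) ht

end Hodge

/-! ### §4 `CH₀(F)` supported on a surface: unconditional statements -/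

/-- **`HC(F × C)` for every smooth projective fourfold `F` whose `CH₀` is supported on a surface and every smooth projective curve `C`** — unconditionally (`HC(F)` and `N¹H³(F) = H³(F)` by Bloch–Srinivas,
the tree's `hodgeConjectureFor_four_of_hasChowZeroSupportedInDimLE` and `supportedClasses_eq_top_of_hasChowZeroSupportedInDimLE_of_lt`). [cite: BlochSrinivas1983, Thm. 1] [cite: VoisinHodgeII2003, §10.2.2 Thm. 10.17, §10.2.3 Prop. 10.26]
[cite: ConteMurre1978, Thm. 1] [cite: Voisin2013GHCBloch, Lemma 2.1 (proof)] [cite: Deligne2000, §1] -/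
theorem hodgeConjectureFor_fourfold_tensor_curve_of_hasChowZeroSupportedInDimLE_two (hF : IsSmoothProjective 4 F) (hC : IsSmoothProjective 1 C) (hW : HasChowZeroSupportedInDimLE F 2) :
    HodgeConjectureFor (4 + 1) (F ⊗ C) := by
  haveI : HodgeTensorFacts.{0, 0} := hodgeTensorFacts_holds
  exact BettiUniverse.hodgeConjectureFor_fourfold_tensor_curve_of_supportedClasses_three_eq_top exists_isReal_hodgeModel_holds hF hC (hF.tensor_holds hC)
    (hodgeConjectureFor_four_of_hasChowZeroSupportedInDimLE hF (by norm_num) hW) (supportedClasses_eq_top_of_hasChowZeroSupportedInDimLE_of_lt hF hW (by norm_num))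

/-- Mirror: **`HC(C × F)`**. [cite: BlochSrinivas1983, Thm. 1] [cite: Voisin2013GHCBloch, Lemma 2.1 (proof)] [cite: Arapura2006, §4 Lemma 4.2] [cite: Deligne2000, §1] -/
theorem hodgeConjectureFor_curve_tensor_fourfold_of_hasChowZeroSupportedInDimLE_two (hC : IsSmoothProjective 1 C) (hF : IsSmoothProjective 4 F) (hW : HasChowZeroSupportedInDimLE F 2) :
    HodgeConjectureFor (1 + 4) (C ⊗ F) :=
  hodgeConjectureFor_tensor_comm_mp hF hC (hodgeConjectureFor_fourfold_tensor_curve_of_hasChowZeroSupportedInDimLE_two hF hC hW)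

/-- **`HC(F × S)` for every smooth projective fourfold `F` whose `CH₀` is supported on a surface and every smooth projective surface `S` with `p_g(S) = h^{2,0}(S) = 0`** — unconditionally.
[cite: BlochSrinivas1983, Thm. 1] [cite: VoisinHodgeII2003, §10.2.2 Thm. 10.17, §10.2.3 Prop. 10.26] [cite: ConteMurre1978, Thm. 1] [cite: Voisin2013GHCBloch, Lemma 2.1 (proof)] [cite: VoisinHodgeI2002, §11.3.3 Lemma 11.41 and p. 287, §11.3.1 Thm. 11.30] [cite: Deligne2000, §1] -/
theorem hodgeConjectureFor_fourfold_tensor_surface_of_hasChowZeroSupportedInDimLE_two_of_pg_zero (hF : IsSmoothProjective 4 F) (hS : IsSmoothProjective 2 S) (hW : HasChowZeroSupportedInDimLE F 2)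
    (hpg : (BettiUniverse.hodge exists_isReal_hodgeModel_holds hS 2).hodgeNumber 2 0 = 0) : HodgeConjectureFor (4 + 2) (F ⊗ S) := by
  haveI : HodgeTensorFacts.{0, 0} := hodgeTensorFacts_holds
  exact BettiUniverse.hodgeConjectureFor_fourfold_tensor_surface_of_supportedClasses_three_eq_top exists_isReal_hodgeModel_holds hF hS (hF.tensor_holds hS)
    (hodgeConjectureFor_four_of_hasChowZeroSupportedInDimLE hF (by norm_num) hW) (supportedClasses_eq_top_of_hasChowZeroSupportedInDimLE_of_lt hF hW (by norm_num)) (mul_eq_zero_of_right _ hpg)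
    (Or.inr hpg)

/-- **`HC(F × T)` for every smooth projective fourfold `F` whose `CH₀` is supported on a surface and every smooth projective threefold `T` whose `CH₀` is supported on a surface with `h^{2,0}(T) = 0`** —
unconditionally (`N¹H³ = H³` on both by Bloch–Srinivas; `HC(F)` by Bloch–Srinivas Thm. 1 (3) / Conte–Murre). [cite: BlochSrinivas1983, Thm. 1] [cite: VoisinHodgeII2003, §10.2.2 Thm. 10.17, Cor. 10.21, §10.2.3 Prop. 10.26]
[cite: ConteMurre1978, Thm. 1] [cite: Voisin2013GHCBloch, Lemma 2.1 (proof)] [cite: VoisinHodgeI2002, §11.3.3 Thm. 11.38, Lemma 11.41 and p. 287, §11.3.1 Thm. 11.30] [cite: Deligne2000, §1] -/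
theorem hodgeConjectureFor_fourfold_tensor_threefold_of_hasChowZeroSupportedInDimLE_two_of_h20_zero (hF : IsSmoothProjective 4 F) (hT : IsSmoothProjective 3 T) (hW : HasChowZeroSupportedInDimLE F 2)
    (hW' : HasChowZeroSupportedInDimLE T 2) (h20 : (BettiUniverse.hodge exists_isReal_hodgeModel_holds hT 2).hodgeNumber 2 0 = 0) : HodgeConjectureFor (4 + 3) (F ⊗ T) := by
  haveI : HodgeTensorFacts.{0, 0} := hodgeTensorFacts_holds
  exact BettiUniverse.hodgeConjectureFor_fourfold_tensor_threefold_of_supportedClasses_three_eq_top exists_isReal_hodgeModel_holds hF hT (hF.tensor_holds hT)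
    (hodgeConjectureFor_four_of_hasChowZeroSupportedInDimLE hF (by norm_num) hW) (supportedClasses_eq_top_of_hasChowZeroSupportedInDimLE_of_lt hF hW (by norm_num))
    (supportedClasses_three_one_eq_top_of_hasChowZeroSupportedInDimLE_two hT hW') (mul_eq_zero_of_right _ h20) (Or.inr h20)

/-- **`HC(F × T)` for every smooth projective fourfold `F` whose `CH₀` is supported on a surface and every smooth projective threefold `T` whose `CH₀` is supported on a CURVE** — unconditionally, with no
Hodge-number hypothesis (`h^{2,0}(T) = 0` by Bloch–Srinivas). [cite: BlochSrinivas1983, Thm. 1] [cite: VoisinHodgeII2003, §10.2.2 Thm. 10.17, Cor. 10.18, Cor. 10.21, §10.2.3 Prop. 10.26] [cite: ConteMurre1978, Thm. 1] [cite: Voisin2013GHCBloch, Lemma 2.1 (proof)]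
[cite: Deligne2000, §1] -/
theorem hodgeConjectureFor_fourfold_tensor_threefold_of_hasChowZeroSupportedInDimLE_two_one (hF : IsSmoothProjective 4 F) (hT : IsSmoothProjective 3 T) (hW : HasChowZeroSupportedInDimLE F 2)
    (hW' : HasChowZeroSupportedInDimLE T 1) : HodgeConjectureFor (4 + 3) (F ⊗ T) :=
  hodgeConjectureFor_fourfold_tensor_threefold_of_hasChowZeroSupportedInDimLE_two_of_h20_zero hF hT hW (hW'.mono (by norm_num))
    (by simpa using (BettiUniverse.hodgeNumber_eq_zero_of_hasChowZeroSupportedInDimLE_of_lt exists_isReal_hodgeModel_holds hT hW' (k := 2) (by norm_num)).2)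

/-- Mirror: **`HC(T × F)`**, `CH₀(T)` on a curve, `CH₀(F)` on a surface. [cite: BlochSrinivas1983, Thm. 1] [cite: Voisin2013GHCBloch, Lemma 2.1 (proof)] [cite: Arapura2006, §4 Lemma 4.2] [cite: Deligne2000, §1] -/
theorem hodgeConjectureFor_threefold_tensor_fourfold_of_hasChowZeroSupportedInDimLE_one_two (hT : IsSmoothProjective 3 T) (hF : IsSmoothProjective 4 F) (hW' : HasChowZeroSupportedInDimLE T 1)
    (hW : HasChowZeroSupportedInDimLE F 2) : HodgeConjectureFor (3 + 4) (T ⊗ F) :=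
  hodgeConjectureFor_tensor_comm_mp hF hT (hodgeConjectureFor_fourfold_tensor_threefold_of_hasChowZeroSupportedInDimLE_two_one hF hT hW hW')

/-- **`HC(F × T)` for `CH₀(F)` supported on a surface and `T` RATIONALLY CHAIN CONNECTED.** [cite: BlochSrinivas1983, Thm. 1] [cite: VoisinHodgeII2003, §10.2.2 Thm. 10.17 and Cor. 10.18, §10.2.3 Prop. 10.26] [cite: Voisin2013GHCBloch, Lemma 2.1 (proof)] [cite: Deligne2000, §1] -/
theorem hodgeConjectureFor_fourfold_tensor_threefold_of_hasChowZeroSupportedInDimLE_two_of_isRationallyChainConnected (hF : IsSmoothProjective 4 F) (hT : IsSmoothProjective 3 T)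
    (hW : HasChowZeroSupportedInDimLE F 2) (hRC : IsRationallyChainConnected T) : HodgeConjectureFor (4 + 3) (F ⊗ T) :=
  hodgeConjectureFor_fourfold_tensor_threefold_of_hasChowZeroSupportedInDimLE_two_one hF hT hW ((hRC.hasChowZeroSupportedInDimLE_zero hT).mono (by norm_num))

/-- **`HC(F × T)` for a FANO fourfold `F` and a FANO threefold `T`, granted the printed fact `KollarMiyaokaMori1992_fano_rationallyChainConnected`** (both `CH₀ = ℤ`). [cite: KollarMiyaokaMori1992, Thm. 3.3]
[cite: BlochSrinivas1983, Thm. 1] [cite: ConteMurre1978, Thm. 1] [cite: Voisin2013GHCBloch, Lemma 2.1 (proof)] [cite: Deligne2000, §1] -/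
theorem hodgeConjectureFor_fourfold_tensor_threefold_of_isFano (hKMM : KollarMiyaokaMori1992_fano_rationallyChainConnected) {F T : SchemeOver ℂ} (hF : IsFano 4 F) (hT : IsFano 3 T) :
    HodgeConjectureFor (4 + 3) (F ⊗ T) :=
  hodgeConjectureFor_fourfold_tensor_threefold_of_hasChowZeroSupportedInDimLE_two_one hF.isSmoothProjective hT.isSmoothProjective ((hKMM.hasChowZeroSupportedInDimLE_zero hF).mono (by norm_num))
    ((hKMM.hasChowZeroSupportedInDimLE_zero hT).mono (by norm_num))

/-- **`HC(F × C)` for a FANO fourfold `F` and every curve `C`, granted `KollarMiyaokaMori1992_fano_rationallyChainConnected`.** [cite: KollarMiyaokaMori1992, Thm. 3.3] [cite: BlochSrinivas1983, Thm. 1] [cite: Voisin2013GHCBloch, Lemma 2.1 (proof)]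
[cite: Deligne2000, §1] -/
theorem hodgeConjectureFor_fourfold_tensor_curve_of_isFano (hKMM : KollarMiyaokaMori1992_fano_rationallyChainConnected) (hF : IsFano 4 F) (hC : IsSmoothProjective 1 C) :
    HodgeConjectureFor (4 + 1) (F ⊗ C) :=
  hodgeConjectureFor_fourfold_tensor_curve_of_hasChowZeroSupportedInDimLE_two hF.isSmoothProjective hC ((hKMM.hasChowZeroSupportedInDimLE_zero hF).mono (by norm_num))

end Literature.AlgebraicGeometry.HodgeTheory

namespace Literature.AlgebraicGeometry.Motives.IsSmoothHypersurface

open Literature.AlgebraicGeometry.Motives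
open Literature.AlgebraicGeometry.HodgeTheory
open Literature.Barriers.HodgeConjecture

variable {e : ℕ} {Y F : SchemeOver ℂ}

/-- **`HC(F × Y)` for every smooth projective fourfold `F` whose `CH₀` is supported on a surface and every smooth hypersurface threefold `Y ⊂ ℙ⁴_ℂ` of degree `1 ≤ e ≤ 4`** — unconditionally (`CH₀(Y)` on a
hyperplane section, `h^{2,0}(Y) = 0`). [cite: BlochSrinivas1983, Thm. 1] [cite: VoisinHodgeII2003, §10.3.1 Thm. 10.31, §10.2.3 Prop. 10.26 and §1.2.3 Cor. 1.24–1.25] [cite: ConteMurre1978, Thm. 1] [cite: Voisin2013GHCBloch, Lemma 2.1 (proof)]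
[cite: Deligne2000, §1] -/
theorem hodgeConjectureFor_fourfold_tensor_of_degree_le_four_of_hasChowZeroSupportedInDimLE_two (hY : IsSmoothHypersurface 3 e Y) (he : 0 < e) (he4 : e ≤ 4) (hF : IsSmoothProjective 4 F)
    (hW : HasChowZeroSupportedInDimLE F 2) : HodgeConjectureFor (4 + 3) (F ⊗ Y) :=
  hodgeConjectureFor_fourfold_tensor_threefold_of_hasChowZeroSupportedInDimLE_two_of_h20_zero hF hY.1 hW (hY.hasChowZeroSupportedInDimLE_of_degree_le_succ (by norm_num) he he4)
    ((BettiUniverse.hodgeClasses_hodge_two_eq_top_iff exists_isReal_hodgeModel_holds hY.1).1 (hY.hodgeClasses_hodge_eq_top_of_two_mul_ne exists_isReal_hodgeModel_holds hY.1 (p := 1) (by norm_num)))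

/-- Mirror: **`HC(Y × F)`**. [cite: BlochSrinivas1983, Thm. 1] [cite: VoisinHodgeII2003, §10.3.1 Thm. 10.31] [cite: Voisin2013GHCBloch, Lemma 2.1 (proof)] [cite: Arapura2006, §4 Lemma 4.2] [cite: Deligne2000, §1] -/
theorem hodgeConjectureFor_tensor_fourfold_of_degree_le_four_of_hasChowZeroSupportedInDimLE_two (hY : IsSmoothHypersurface 3 e Y) (he : 0 < e) (he4 : e ≤ 4) (hF : IsSmoothProjective 4 F)
    (hW : HasChowZeroSupportedInDimLE F 2) : HodgeConjectureFor (3 + 4) (Y ⊗ F) :=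
  hodgeConjectureFor_tensor_comm_mp hF hY.1 (hY.hodgeConjectureFor_fourfold_tensor_of_degree_le_four_of_hasChowZeroSupportedInDimLE_two he he4 hF hW)

end Literature.AlgebraicGeometry.Motives.IsSmoothHypersurface

end
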